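import Literature.AnabelianGeometry.EtaleTheta.Prop42Sub
import Literature.AnabelianGeometry.EtaleTheta.Discharge.Sec4RootDivisors
import Literature.AnabelianGeometry.EtaleTheta.Discharge.Sec4Model
import HarnessLib

/-!
# [EtTh] Prop. 4.2 (iii): the sub-node L02 `RootFractionPair` («Φ perfect ⇒ the divisors of zeroes and
# poles of the root belong to Φ(−)» + [FrdI] Def. 1.3 (iii)(d)) DISCHARGED modulo [FrdI] facts

Mochizuki, *The étale theta function …*, Publ. RIMS **45** (2009), §4, Prop. 4.2 (iii), proof PDF p.89
L80–83 («since, moreover, the divisor monoid `Φ` is assumed to be perfect, it follows that the divisors of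
zeroes and poles of such an `N`-th root belong to `Φ(−)` of the tempered covering in question») and p.90
L6–10 («[FrdI], Definition 1.3, (iii), (d) [on the existence of pre-steps with prescribed zero divisor]»)
[cite: MochizukiEtTh2009, Prop 4.2 p.89]. PROOF-ONLY companion (abc-iut cell, writer abc-iut-w5-d134) of
the sub-DAG statements file `Prop42Sub.lean` (`plan/L2/SUBDAG-EtTh-Prop42.md`, row EtTh:Prop4.2(iii)/L02)
over abc-iut-L2-t3's `BiKummerSetting` / `FractionPair`; nothing there is edited, no definition and no named
fact is introduced here.

ROW L02: along a morphism `φ : A' → A_⊙`, an `N`-th root `g ∈ O^×(A'^birat)` of `((φ)^birat)^* f` is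
computed by a fraction-pair `(s'_N, s''_N) : A' → B_N` whose zero divisor / divisor of poles are the
`N`-th roots in `Φ(A'^bs)` of `Base(φ)^* Div(s')`, `Base(φ)^* Div(s'')`. PROOF, for EVERY setting `S`
(whose `Φ` is perfect, `BiKummerSetting.isPerfect`), modulo the [FrdI] facts: `Φ` divisorial ([FrdI]
Thm. 5.2 (ii)), the birational DICTIONARY `toB : O^×(A^birat) ↪ B(A_D)^×` (injective; computing
fractions; compatible with `pullFrac`), and the two laws of "disjoint supports" ([FrdI] Prop. 4.1 (iii)):
roots of elements with disjoint supports have disjoint supports, pull-back along a base morphism preserves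
disjointness — the hypothesis style of abc-iut-L6-t12's `prop42_i_of`/`prop42_ii_of`. Construction in the
model Frobenioid ([FrdI] Thm. 5.2 (i)): `a := (Base(φ)^* Div(s'))^{1/N}`, `b := (Base(φ)^* Div(s''))^{1/N}`,
`B_N := (A'^bs, [A'] + b)`, `s''_N := (1, id, b, 1)`, `s'_N := (1, id, a, toB g)` — relation (d) for `s'_N`
is the identity `[a] = [b] + Div_B(toB g)` in `Φ(A'^bs)^gp`, which holds because its `N`-th power is
`Base(φ)^*([Div s'] − [Div s'']) = Base(φ)^* Div_B(toB f) = Div_B(toB g^N)` and `Φ^gp` is torsion-free for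
`Φ` divisorial (`gp_pow_injective_of_isDivisorial`). Typed ≠ proved for the other rows; nothing here takes a
side on [IUTchIII] Cor. 3.12.
-/

namespace Literature.AnabelianGeometry.EtaleTheta

open CategoryTheory Opposite Literature.AlgebraicGeometry.Frobenioids
open Literature.AlgebraicGeometry.Frobenioids.PreFrobenioid (pull_inv_pull_eq pull_pull_inv_eq
  pull_injective pullGp_of' pullGp_inv_pullGp pullGp_pullGp_inv pullGp_injective)

universe u₀ v₀ u v w

variable {K : Type u₀} [Field K]

namespace BiKummerSetting

/-- **`Φ^gp` is torsion-free for `Φ` divisorial**: `x^N = y^N ⇒ x = y` in the Grothendieck group of a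
divisorial monoid (write `x/y = [p] − [q]`; then `[p^N] = [q^N]`, `p^N = q^N` by integrality, `p = q` by
`pow_injective_of_isDivisorial`). [cite: MochizukiFrdI2008, §0 p.11] -/
theorem gp_pow_injective_of_isDivisorial {M : Type w} [CommMonoid M] (hM : IsDivisorial M) (N : ℕ+)
    {x y : Algebra.GrothendieckGroup M} (h : x ^ (N : ℕ) = y ^ (N : ℕ)) : x = y := by
  have hint := hM.isPreDivisorial.isIntegral
  obtain ⟨p, q, hpq⟩ := gp_exists_mul_of_eq_of (x / y)
  have hz : (x / y) ^ (N : ℕ) = 1 := by rw [div_pow, h, div_self']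
  have hpqN : Algebra.GrothendieckGroup.of (q ^ (N : ℕ)) = Algebra.GrothendieckGroup.of (p ^ (N : ℕ)) := by
    rw [map_pow, map_pow, ← hpq, mul_pow, hz, one_mul]
  have hqp : q = p := pow_injective_of_isDivisorial hM N (hint.injective_of hpqN)
  rw [hqp] at hpq
  have h1 : x / y = 1 := mul_right_cancel (hpq.trans (one_mul _).symm)
  exact div_eq_one.mp h1

variable {X : SemiGraphs.TemperedArithmeticGroup.{u₀} K} {D₀ : Type u₀} [Category.{v₀} D₀]
  {V : FrdIMonoidStub.{w}} {T : RealifiedDivisorMonoids (D₀ := D₀) V} {D : Type u} [Category.{v} D]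
  {VD : FrdICatStub.{u, v, w} D} (S : BiKummerSetting X T D VD)

namespace Prop42Sub

variable (pullFrac : ∀ {A A' : S.C} (_ : A' ⟶ A), S.biratUnits A → S.biratUnits A')

/-- **The divisor of the fraction `f` read through the dictionary**: for a fraction-pair `(s', s'') : A → B`
for `f`, `[Div(s')] = [Div(s'')] · Div_B(toB f)` in `Φ(A^bs)^gp` (relation (d) of [FrdI] Thm. 5.2 (i) for the
two base-equivalent pre-steps, and `toB(f) · u_{s''} = u_{s'}`). [cite: MochizukiEtTh2009, Def 4.1 p.87] -/
theorem of_div_num_eq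
    (toB : ∀ A : S.C, S.biratUnits A →* (S.tf.ratFnFunctor.obj (op A.base))ˣ)
    (hfrac : ∀ {A B : S.C} (s' s'' : A ⟶ B) (h' : S.IsPreStep s') (h'' : S.IsPreStep s'')
      (hb : PreFrobenioid.BaseEquivalent S.F s' s''),
      (toB A (S.fracOf s' s'' h' h'' hb) : S.tf.ratFnFunctor.obj (op A.base)) *
        ModelFrobenioid.unit s'' = ModelFrobenioid.unit s')
    {A B : S.C} (f : S.biratUnits A) (P : S.FractionPair f B) :
    Algebra.GrothendieckGroup.of (ModelFrobenioid.div P.num) =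
      Algebra.GrothendieckGroup.of (ModelFrobenioid.div P.den) *
        divB S.tf.divisorMonoid S.tf.ratFnFunctor S.tf.divBNatTrans (op A.base)
          (toB A f : S.tf.ratFnFunctor.obj (op A.base)) := by
  have hn : ModelFrobenioid.degFr P.num = 1 := P.isPreStep_num.1
  have hd : ModelFrobenioid.degFr P.den = 1 := P.isPreStep_den.1
  have hb : ModelFrobenioid.baseMap P.den = ModelFrobenioid.baseMap P.num := P.base_eq.symm
  have hf : (toB A f : S.tf.ratFnFunctor.obj (op A.base)) * ModelFrobenioid.unit P.den =
      ModelFrobenioid.unit P.num := by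
    have h := hfrac P.num P.den P.isPreStep_num P.isPreStep_den P.base_eq
    rwa [P.frac_eq] at h
  have Rn := ModelFrobenioid.rel P.num
  have Rd := ModelFrobenioid.rel P.den
  rw [hn, PNat.one_coe, pow_one, ← hf, map_mul] at Rn
  rw [hd, PNat.one_coe, pow_one, hb] at Rd
  -- `A.cls · [Div s'] = P · Div_B(toB f) · Div_B(u'')`, `A.cls · [Div s''] = P · Div_B(u'')`
  apply mul_left_cancel (a := A.cls)
  rw [← mul_assoc, Rd, Rn]
  ac_rfl

/-- **(iii)/L02 `RootFractionPair` DISCHARGED modulo [FrdI] facts** (`Φ` divisorial, the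
injective birational dictionary `toB` with its fraction and transport laws, and the two [FrdI] Prop. 4.1 (iii)
laws of disjoint supports), using the perfection of `Φ` carried by the setting (`BiKummerSetting.isPerfect`).
[cite: MochizukiEtTh2009, Prop 4.2 p.89] -/
theorem rootFractionPair_of (hΦd : Objectwise (fun M _ => IsDivisorial M) S.tf.divisorMonoid)
    (toB : ∀ A : S.C, S.biratUnits A →* (S.tf.ratFnFunctor.obj (op A.base))ˣ)
    (htoB : ∀ A : S.C, Function.Injective (toB A))
    (hfrac : ∀ {A B : S.C} (s' s'' : A ⟶ B) (h' : S.IsPreStep s') (h'' : S.IsPreStep s'')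
      (hb : PreFrobenioid.BaseEquivalent S.F s' s''),
      (toB A (S.fracOf s' s'' h' h'' hb) : S.tf.ratFnFunctor.obj (op A.base)) *
        ModelFrobenioid.unit s'' = ModelFrobenioid.unit s')
    (hpull : ∀ {A A' : S.C} (φ : A' ⟶ A) (x : S.biratUnits A),
      (toB A' (pullFrac φ x) : S.tf.ratFnFunctor.obj (op A'.base)) =
        pull S.tf.ratFnFunctor (ModelFrobenioid.baseMap φ) (toB A x))
    (hDSroot : ∀ {A : Dᵒᵖ} {a b : S.tf.Φ.carrier A} (N : ℕ+),
      S.DisjointSupports (a ^ (N : ℕ)) (b ^ (N : ℕ)) → S.DisjointSupports a b)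
    (hDSpull : ∀ {A A' : D} (e : A' ⟶ A) {a b : S.tf.Φ.carrier (op A)}, S.DisjointSupports a b →
      S.DisjointSupports (pull S.tf.divisorMonoid e a) (pull S.tf.divisorMonoid e b)) :
    RootFractionPair S pullFrac := by
  intro B f P N A' φ g _hφ hg
  -- the roots `a = (φ^* Div s')^{1/N}`, `b = (φ^* Div s'')^{1/N}` in the perfect monoid `Φ(A'^bs)`
  set pn := pull S.tf.divisorMonoid (ModelFrobenioid.baseMap φ) (ModelFrobenioid.div P.num) with hpn
  set pd := pull S.tf.divisorMonoid (ModelFrobenioid.baseMap φ) (ModelFrobenioid.div P.den) with hpd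
  set a : S.tf.divisorMonoid.obj (op A'.base) := (S.isPerfect (op A'.base)).root N pn with ha
  set b : S.tf.divisorMonoid.obj (op A'.base) := (S.isPerfect (op A'.base)).root N pd with hb
  have haN : a ^ (N : ℕ) = pn := (S.isPerfect (op A'.base)).root_pow N pn
  have hbN : b ^ (N : ℕ) = pd := (S.isPerfect (op A'.base)).root_pow N pd
  have hDS : S.DisjointSupports a b := by
    apply hDSroot N
    convert hDSpull (ModelFrobenioid.baseMap φ) P.disjointSupports using 2
    · exact haN
    · exact hbN
  -- the key identity `[a] = [b] · Div_B(toB g)` in `Φ(A'^bs)^gp`: compare `N`-th powers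
  have oa : Algebra.GrothendieckGroup.of a ^ (N : ℕ) = Algebra.GrothendieckGroup.of pn := by
    rw [← map_pow, haN]
  have ob : Algebra.GrothendieckGroup.of b ^ (N : ℕ) = Algebra.GrothendieckGroup.of pd := by
    rw [← map_pow, hbN]
  have dg : divB S.tf.divisorMonoid S.tf.ratFnFunctor S.tf.divBNatTrans (op A'.base)
        (toB A' g : S.tf.ratFnFunctor.obj (op A'.base)) ^ (N : ℕ) =
      pullGp S.tf.divisorMonoid (ModelFrobenioid.baseMap φ)
        (divB S.tf.divisorMonoid S.tf.ratFnFunctor S.tf.divBNatTrans (op S.Aodot.base)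
          (toB S.Aodot f : S.tf.ratFnFunctor.obj (op S.Aodot.base))) := by
    rw [← map_pow, ← Units.val_pow_eq_pow_val, ← map_pow, hg, hpull, ModelFrobenioid.pullGp_divB_pull]
  have hkey : Algebra.GrothendieckGroup.of a =
      Algebra.GrothendieckGroup.of b *
        divB S.tf.divisorMonoid S.tf.ratFnFunctor S.tf.divBNatTrans (op A'.base)
          (toB A' g : S.tf.ratFnFunctor.obj (op A'.base)) := by
    apply gp_pow_injective_of_isDivisorial (hΦd A'.base) N
    rw [mul_pow, oa, ob, dg, hpn, hpd, ← pullGp_of', ← pullGp_of', ← map_mul,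
      ← of_div_num_eq S toB hfrac f P]
  -- the codomain `B_N := (A'^bs, [A'] + [b])` and the two pre-steps
  let BN : S.C := ⟨A'.base, A'.cls * Algebra.GrothendieckGroup.of b⟩
  have hrel_den : A'.cls ^ ((1 : ℕ+) : ℕ) * Algebra.GrothendieckGroup.of b =
      pullGp S.tf.divisorMonoid (𝟙 A'.base) BN.cls *
        divB S.tf.divisorMonoid S.tf.ratFnFunctor S.tf.divBNatTrans (op A'.base) 1 := by
    rw [PNat.one_coe, pow_one, pullGp_id, map_one, mul_one]
  have hrel_num : A'.cls ^ ((1 : ℕ+) : ℕ) * Algebra.GrothendieckGroup.of a =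
      pullGp S.tf.divisorMonoid (𝟙 A'.base) BN.cls *
        divB S.tf.divisorMonoid S.tf.ratFnFunctor S.tf.divBNatTrans (op A'.base)
          (toB A' g : S.tf.ratFnFunctor.obj (op A'.base)) := by
    rw [PNat.one_coe, pow_one, pullGp_id, hkey, mul_assoc]
  let sN : A' ⟶ BN := ModelFrobenioid.mkHom A' BN 1 _ _ _ hrel_num
  let tN : A' ⟶ BN := ModelFrobenioid.mkHom A' BN 1 _ _ _ hrel_den
  have hsN : S.IsPreStep sN :=
    ⟨rfl, by show IsIso (ModelFrobenioid.baseMap sN); rw [ModelFrobenioid.baseMap_mkHom]; infer_instance⟩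
  have htN : S.IsPreStep tN :=
    ⟨rfl, by show IsIso (ModelFrobenioid.baseMap tN); rw [ModelFrobenioid.baseMap_mkHom]; infer_instance⟩
  have hbe : PreFrobenioid.BaseEquivalent S.F sN tN := rfl
  -- the fraction of the pair is `g` (dictionary + injectivity)
  have hfracN : S.fracOf sN tN hsN htN hbe = g := by
    apply htoB A'
    apply Units.ext
    have h := hfrac sN tN hsN htN hbe
    rw [ModelFrobenioid.unit_mkHom, ModelFrobenioid.unit_mkHom, mul_one] at h
    exact h
  refine ⟨BN, ⟨sN, tN, hsN, htN, hbe, hfracN, hDS⟩, haN, hbN⟩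

end Prop42Sub

/-- **L02 `RootFractionPair` for the MODEL INSTANCE** `mkOfModel` (abc-iut-L2-t9; dictionary = identity,
transport `pullFracModel`): holds given `Φ` divisorial and the two [FrdI] Prop. 4.1 (iii) laws of the
disjoint-supports predicate `DS` (roots, pull-backs). [cite: MochizukiEtTh2009, Prop 4.2 p.89] -/
theorem rootFractionPair_mkOfModel (tf : TemperedFrobenioid T D VD) (hZ : tf.monoidType = MonoidType.Z)
    (hP : ∀ A : Dᵒᵖ, IsPerfect (tf.Φ.carrier A)) (hBΛ : ∀ (Y : D₀ᵒᵖ) (b : T.BΛ.obj Y), IsUnit b)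
    (DS : ∀ {A : Dᵒᵖ}, tf.Φ.carrier A → tf.Φ.carrier A → Prop) (IG : D → Prop)
    (gS : ∀ A : D, IG A → (X.Pi →* Aut A)) (gSs : ∀ (A : D) (h : IG A), Function.Surjective (gS A h))
    (NH : Subgroup (Field.absoluteGaloisGroup K) → tf.category → ℕ+ → Prop)
    (AB : ∀ {A B : tf.category}, Subgroup (Aut A) → (A ⟶ A) → (A ⟶ B) → Prop) (A₀ : tf.category)
    (hA₀ : PreFrobenioid.IsFrobeniusTrivial tf.toElem A₀) (hA₀' : IG A₀.base)
    (hΦd : Objectwise (fun M _ => IsDivisorial M) tf.divisorMonoid)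
    (hDSroot : ∀ {A : Dᵒᵖ} {a b : tf.Φ.carrier A} (N : ℕ+), DS (a ^ (N : ℕ)) (b ^ (N : ℕ)) → DS a b)
    (hDSpull : ∀ {A A' : D} (e : A' ⟶ A) {a b : tf.Φ.carrier (op A)}, DS a b →
      DS (pull tf.divisorMonoid e a) (pull tf.divisorMonoid e b)) :
    Prop42Sub.RootFractionPair (mkOfModel X tf hZ hP hBΛ DS IG gS gSs NH AB A₀ hA₀ hA₀')
      (fun φ x => tf.pullFracModel φ x) :=
  Prop42Sub.rootFractionPair_of (mkOfModel X tf hZ hP hBΛ DS IG gS gSs NH AB A₀ hA₀ hA₀')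
    (fun φ x => tf.pullFracModel φ x) hΦd
    (fun A => MonoidHom.id (tf.biratUnitsModel A)) (fun _ => Function.injective_id)
    (fun s' s'' _ _ _ => coe_fracOfModel_mul_unit tf hBΛ s' s'') (fun _ _ => rfl) hDSroot hDSpull

end BiKummerSetting

end Literature.AnabelianGeometry.EtaleTheta
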